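import Summits.Ventures.HSemireg.Pad4TowerHalfSumLattice

/-!
# PAD-4 on 𝔅(μ₄): HALF-SUM LATTICE LAW, sequel — `|μ|² ≥ 1024`, every `◇_h` design qualifies, the MASS LAW `16 ∣ M₀` (even `h`),
# and the E-FREE LADDER `N(e-free word of degree k) ∈ 2^k ℤ` (HSemireg support file; phase-torus line, «control» lens g6, module 2 of 2)

Crux of record: `Summit.HodgeConjecture.HodgeConjecture.Theses.EightfoldBlochSeeds.BlochSeedDiscOne`
(= `HasHyperbolicBlochSeed 4 1`, item stmt-HodgeConjecture-18881; skeleton `Lines/birth.lean`, STUB R `stub_rung_pad4_seedAt`,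
named technique = PAD-4 two-level ⊕-block design with a TWO-TERM line-bundle presentation).
Nothing in this file proves HC, HC_AV, HC_CM, H2 or item 18881; census-neutral (no SAT∕UNSAT row is added or changed).

WHAT THIS FILE IS (tree copy of the tail of §5 and §6–§8 of the crux workfile `Cruxes/BlochSeedDiscOne/HalfSumLattice.lean` v3
23bb976bcaee1627, author plan-lens-HodgeAV-control g6, statements verbatim; memo `Cruxes/BlochSeedDiscOne/BOX-LAW-g6.md` §10 (v1.3–v1.5);
director-hodge words «K-HALFSUM» and the mass law; critic idea-crit-6 g12 KERNEL PLATE):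
* **`parityAxialDesign_norm_mu_ge`** — `μ ≠ 0 ⇒ |μ|² ≥ 1024` for every integer (A1)-clean parity-axial design;
* §6 every letter of `◇_h` is parity-axial (`parityAxial_of_inDiamond`, any `h`, even or odd) ⇒ **`diamondDesign_mu_mem32`**;
* §7 the mass `M₀ = N(cccc)` (`M0`): `Σ ν ∏ D(x_f)` with `D = 2(h − α) − (1−i)β − (1+i)β̄` (`cD`) equals `16·Σ ν ∏(h − α_f)` on the e-free
  words (`halfSum_DDDD`), whence **`parityAxialDesign_M0_dvd`** (`16 ∣ M₀` for even `h`) and `diamondDesign_M0_mu_mem`;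
* §8 the e-free ladder (`ladder_core`, `parityAxialDesign_ladder`): `N(w) ∈ 2^k ℤ` for the e-free words `lw1 … lw8` of degree `k`.
Everything here is PROVED (axioms `propext`, `Classical.choice`, `Quot.sound`; no `sorry`, no named fact, no instance, no notation).

WHAT IT IS NOT: a statement about sheaves, monads, a SOURCE or a SEED; the exact machine lattice `16ℤ × 32ℤ × 32ℤ·i` of `◇_h`
(even `h ≤ 16`, `ctl/fulllattice.py`) is data, not a tree theorem; sharpness of `32` is `Pad4TowerSharpWitness32.mu32_attained`.
Tree filing: hsemireg-phasetorus-typer-1 g2.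
-/

namespace Summit.Ventures.HSemireg.HalfSum

open Finset BigOperators Summit.Ventures.HSemireg Summit.Ventures.HSemireg.Pad4Tower

/-! ## §5 (tail) the gap `|μ|² ≥ 1024` -/

/-- `|μ|² ≥ 1024` for every non-zero such `μ`. -/
theorem parityAxialDesign_norm_mu_ge (C : MConfig) (mN mP : MCell → ℤ)
    (hpa : ∀ Z ∈ C.lower ∪ C.upper, ∀ f, ParityAxial (Z f)) (hA1 : ClassScreen (C.wch mN mP))
    (hμ : C.wch mN mP eWord ≠ 0) : 1024 ≤ (C.wch mN mP eWord).norm := by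
  obtain ⟨-, ⟨a, ha⟩, ⟨b, hb⟩⟩ := parityAxialDesign_mu_dvd C mN mP hpa hA1
  rw [Zsqrtd.norm_def, ha, hb]
  have hab : a ≠ 0 ∨ b ≠ 0 := by
    by_contra h0
    push Not at h0
    apply hμ
    rw [Zsqrtd.ext_iff, ha, hb, h0.1, h0.2]; simp
  rcases hab with h | h
  · have ha2 : 0 < a ^ 2 := by positivity
    nlinarith [sq_nonneg b]
  · have hb2 : 0 < b ^ 2 := by positivity
    nlinarith [sq_nonneg a]

/-! ## §6 every `◇_h` design qualifies (any `h`, even or odd) -/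

/-- every letter of `◇_h` is parity-axial (any `h`). -/
theorem parityAxial_of_inDiamond {h : ℤ} {x : BPoint} (hx : InDiamond h x) : ParityAxial x := by
  have hax : x.2.1 = 0 ∨ x.2.2 = 0 := by
    rcases hx.1 with h0 | hax
    · left; exact (Prod.ext_iff.mp h0).1
    · rcases hax with ⟨-, h2⟩ | ⟨h1, -⟩
      · exact Or.inr h2
      · exact Or.inl h1
  refine ⟨hax, ?_⟩
  have hpar := hx.2.2.1
  unfold absCharge chargeOf at hpar
  rcases hax with h0 | h0 <;> rw [h0] at hpar ⊢ <;> simp only [zero_sub, sub_zero, abs_neg, add_zero] at hpar ⊢ <;>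
    rcases abs_choice x.2.2 with e | e <;> rcases abs_choice x.2.1 with e' | e' <;> omega

/-- **COROLLARY (`◇_h`, every `h`)**: every integer (A1)-clean design supported in `◇_h` has `μ ∈ 32ℤ[i]` and `16 ∣ N(uuuu)`. -/
theorem diamondDesign_mu_mem32 (h : ℤ) (C : MConfig) (mN mP : MCell → ℤ)
    (hC : MConfig.InDiamond h C) (hA1 : ClassScreen (C.wch mN mP)) :
    (16 : ℤ) ∣ (C.wch mN mP uWord).re ∧ (32 : ℤ) ∣ (C.wch mN mP eWord).re ∧ (32 : ℤ) ∣ (C.wch mN mP eWord).im := by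
  have hD : ∀ Z ∈ C.lower ∪ C.upper, MCell.InDiamond h Z := fun Z hZ => by
    rcases Finset.mem_union.mp hZ with hZ | hZ
    · exact hC.1 Z hZ
    · exact hC.2 Z hZ
  exact parityAxialDesign_mu_dvd C mN mP (fun Z hZ f => parityAxial_of_inDiamond (hD Z hZ f)) hA1

/-! ## §7 the mass `M₀ = N(cccc)`: `16 ∣ M₀` for even `h` (§9 Q-B of the memo answered NO) -/

/-- `M₀ = Σν ∏_f (h − α_f)` (= `BandPhaseTorus.mass`, = the moment `N(cccc)`). -/
def M0 (h : ℤ) (C : MConfig) (mN mP : MCell → ℤ) : ℤ :=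
  (∑ Z ∈ C.lower, mN Z * ∏ f, LinePhaseTorus.lineCharge h Z f) - ∑ P ∈ C.upper, mP P * ∏ f, LinePhaseTorus.lineCharge h P f

/-- `M₀` as an integer pairing. -/
theorem M0_eq_HSint (h : ℤ) (C : MConfig) (mN mP : MCell → ℤ) :
    M0 h C mN mP = HSint C mN mP (fun _ x => h - x.1) := by
  unfold M0 HSint LinePhaseTorus.lineCharge; rfl

/-- splitting the screened expansion: e-free words, plus `eeee ↦ μ`, `ēēēē ↦ μ̄`. -/
theorem sum_screenFilter (t : CWord → GaussianInt) :
    ∑ w ∈ (Finset.univ.filter fun w : CWord => EFree w ∨ w = eWord ∨ w = ebarWord), t w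
      = (∑ w ∈ (Finset.univ.filter fun w : CWord => EFree w), t w) + t eWord + t ebarWord := by
  have hne : eWord ≠ ebarWord := by decide
  have he : ¬ EFree eWord := by decide
  have hb : ¬ EFree ebarWord := by decide
  have hset : (Finset.univ.filter fun w : CWord => EFree w ∨ w = eWord ∨ w = ebarWord)
      = (Finset.univ.filter fun w : CWord => EFree w) ∪ {eWord, ebarWord} := by
    ext w
    simp only [Finset.mem_filter, Finset.mem_univ, true_and, Finset.mem_union, Finset.mem_insert,
      Finset.mem_singleton]
  have hdis : Disjoint (Finset.univ.filter fun w : CWord => EFree w) {eWord, ebarWord} := by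
    rw [Finset.disjoint_left]
    intro w hw
    rw [Finset.mem_filter] at hw
    simp only [Finset.mem_insert, Finset.mem_singleton, not_or]
    exact ⟨fun h0 => he (h0 ▸ hw.2), fun h0 => hb (h0 ▸ hw.2)⟩
  rw [hset, Finset.sum_union hdis, Finset.sum_pair hne]; ring

/-- a pairing splits over the screen: e-mixed words die under (A1)(i), e-free words remain. -/
theorem HS_split (C : MConfig) (mN mP : MCell → ℤ) (c : Fin 4 → Fin 6 → GaussianInt)
    (hA1 : ClassScreen (C.wch mN mP)) :
    HS C mN mP c = (∑ w ∈ (Finset.univ.filter fun w : CWord => EFree w), (∏ f, c f (w f)) * C.wch mN mP w)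
      + (∏ f, c f 3) * C.wch mN mP eWord + (∏ f, c f 4) * C.wch mN mP ebarWord := by
  rw [HS_expand_screen C mN mP c hA1, sum_screenFilter]
  have e2 : (∏ f, c f (eWord f)) = ∏ f, c f 3 := Finset.prod_congr rfl fun f _ => by fin_cases f <;> rfl
  have e3 : (∏ f, c f (ebarWord f)) = ∏ f, c f 4 := Finset.prod_congr rfl fun f _ => by fin_cases f <;> rfl
  rw [e2, e3]

/-- the co-letter functional `c = h·1 − u` (value `h − α`). -/
def cH (h : ℤ) : Fin 6 → GaussianInt := ![(h : GaussianInt), -1, 0, 0, 0, 0]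
/-- `D = 2c − (1 − i)e − (1 + i)ē` (value `2(h − α − Re β − Im β) = 2h − G`). -/
def cD (h : ℤ) : Fin 6 → GaussianInt := ![2 * (h : GaussianInt), -2, 0, ⟨-1, 1⟩, ⟨-1, -1⟩, 0]

/-- `lfun (cH h) x = h − α`. -/
theorem lfun_cH (h : ℤ) (x : BPoint) : lfun (cH h) x = ((h - x.1 : ℤ) : GaussianInt) := by
  rw [lfun, Fin.sum_univ_six, Zsqrtd.ext_iff]
  simp [cH, bphi, phiVec]
  ring

/-- `lfun (cD h) x = 2(h − α) − G-type unit part`: the values of `cD`. -/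
theorem lfun_cD (h : ℤ) (x : BPoint) :
    lfun (cD h) x = ((2 * (h - x.1 - x.2.1 - x.2.2) : ℤ) : GaussianInt) := by
  rw [lfun, Fin.sum_univ_six, Zsqrtd.ext_iff]
  simp [cD, bphi, phiVec]
  constructor <;> ring

/-- off the `e, ē` letters `cD = 2·cH`. -/
theorem cD_eq_two_mul_cH (h : ℤ) (j : Fin 6) (h3 : j ≠ 3) (h4 : j ≠ 4) : cD h j = 2 * cH h j := by
  fin_cases j <;> first | exact absurd rfl h3 | exact absurd rfl h4 | simp [cD, cH]

/-- on an e-free word the `cD`-coefficient is `16×` the `cH`-coefficient. -/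
theorem efree_coef_cD (h : ℤ) (w : CWord) (hw : EFree w) :
    (∏ f, cD h (w f)) = 16 * ∏ f, cH h (w f) := by
  rw [Finset.prod_congr rfl fun f _ => cD_eq_two_mul_cH h (w f) (hw f).1 (hw f).2, Finset.prod_mul_distrib,
    Finset.prod_const, Finset.card_univ, Fintype.card_fin]
  norm_num

/-- **`Σν ∏ D = 16·M₀ − 4μ − 4μ̄`.** -/
theorem halfSum_DDDD (h : ℤ) (C : MConfig) (mN mP : MCell → ℤ) (hA1 : ClassScreen (C.wch mN mP)) :
    HS C mN mP (fun _ => cD h) = 16 * HS C mN mP (fun _ => cH h) + (-4) * C.wch mN mP eWord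
      + (-4) * C.wch mN mP ebarWord := by
  rw [HS_split C mN mP _ hA1, HS_split C mN mP _ hA1]
  have d3 : (∏ _f : Fin 4, cD h 3) = -4 := by
    rw [Finset.prod_const, Finset.card_univ, Fintype.card_fin]; simp [cD]; decide
  have d4 : (∏ _f : Fin 4, cD h 4) = -4 := by
    rw [Finset.prod_const, Finset.card_univ, Fintype.card_fin]; simp [cD]; decide
  have c3 : (∏ _f : Fin 4, cH h 3) = 0 := by
    rw [Finset.prod_const, Finset.card_univ, Fintype.card_fin]; simp [cH]
  have c4 : (∏ _f : Fin 4, cH h 4) = 0 := by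
    rw [Finset.prod_const, Finset.card_univ, Fintype.card_fin]; simp [cH]
  rw [d3, d4, c3, c4, zero_mul, zero_mul, add_zero, add_zero, Finset.mul_sum]
  congr 1; congr 1
  refine Finset.sum_congr rfl fun w hw => ?_
  rw [Finset.mem_filter] at hw
  rw [efree_coef_cD h w hw.2, mul_assoc]

/-- **MASS LAW.**  For even `h` and every integer (A1)-clean design with parity-axial letters: `16 ∣ M₀ = Σν∏(h − α_f)`
(and `2M₀ ≡ (re μ)/… `: precisely `16 M₀ − 8 re μ ∈ 256ℤ`). -/
theorem parityAxialDesign_M0_dvd (h : ℤ) (hh : 2 ∣ h) (C : MConfig) (mN mP : MCell → ℤ)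
    (hpa : ∀ Z ∈ C.lower ∪ C.upper, ∀ f, ParityAxial (Z f)) (hA1 : ClassScreen (C.wch mN mP)) :
    (16 : ℤ) ∣ M0 h C mN mP := by
  obtain ⟨-, ⟨j, hj⟩, -⟩ := parityAxialDesign_mu_dvd C mN mP hpa hA1
  have hstar : C.wch mN mP ebarWord = star (C.wch mN mP eWord) := C.wch_ebarWord_eq_star mN mP
  have eD := halfSum_DDDD h C mN mP hA1
  rw [HS_eq_HSint C mN mP (fun _ => cD h) (fun _ x => 2 * (h - x.1 - x.2.1 - x.2.2)) (fun _ x => lfun_cD h x),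
    HS_eq_HSint C mN mP (fun _ => cH h) (fun _ x => h - x.1) (fun _ x => lfun_cH h x), ← M0_eq_HSint, hstar] at eD
  have dD : (256 : ℤ) ∣ HSint C mN mP (fun _ x => 2 * (h - x.1 - x.2.1 - x.2.2)) :=
    dvd_HSint _ _ _ _ _ fun Z hZ => dvd256_prod4 _ fun f => by
      obtain ⟨a, ha⟩ := hh
      obtain ⟨b, hb⟩ := (hpa Z hZ f).2
      exact ⟨a - b, by linarith⟩
  have eDre := congrArg Zsqrtd.re eD
  norm_num at eDre
  obtain ⟨k, hk⟩ := dD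
  rw [hk, hj] at eDre
  exact ⟨k + j, by linarith⟩

/-- **COROLLARY (`◇_h`, `h` even)**: `(M₀, μ) ∈ 16ℤ × 32ℤ[i]` — the full clean-design lattice computed by `fulllattice.py` is exactly this. -/
theorem diamondDesign_M0_mu_mem (h : ℤ) (hh : 2 ∣ h) (C : MConfig) (mN mP : MCell → ℤ)
    (hC : MConfig.InDiamond h C) (hA1 : ClassScreen (C.wch mN mP)) :
    (16 : ℤ) ∣ M0 h C mN mP ∧ (32 : ℤ) ∣ (C.wch mN mP eWord).re ∧ (32 : ℤ) ∣ (C.wch mN mP eWord).im := by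
  have hD : ∀ Z ∈ C.lower ∪ C.upper, MCell.InDiamond h Z := fun Z hZ => by
    rcases Finset.mem_union.mp hZ with hZ | hZ
    · exact hC.1 Z hZ
    · exact hC.2 Z hZ
  have hpa : ∀ Z ∈ C.lower ∪ C.upper, ∀ f, ParityAxial (Z f) := fun Z hZ f => parityAxial_of_inDiamond (hD Z hZ f)
  exact ⟨parityAxialDesign_M0_dvd h hh C mN mP hpa hA1, (parityAxialDesign_mu_dvd C mN mP hpa hA1).2⟩

/-! ## §8 the e-free ladder: `N(e-free word of degree k) ∈ 2^k ℤ` (`k = 1, …, 8`; `k = 4` is §5) -/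

/-- the integer letter table on e-free letters. -/
def iphi (x : BPoint) : Fin 6 → ℤ := ![1, x.1, x.1, 0, 0, x.1 ^ 2 - x.2.1 ^ 2 - x.2.2 ^ 2]

/-- off the `e, ē` letters the class letters are the integers `iphi`. -/
theorem bphi_eq_iphi (x : BPoint) (j : Fin 6) (h3 : j ≠ 3) (h4 : j ≠ 4) :
    bphi x j = ((iphi x j : ℤ) : GaussianInt) := by
  fin_cases j <;> first | exact absurd rfl h3 | exact absurd rfl h4 | simp [bphi, phiVec, iphi]

/-- e-free class values are rational integers. -/
theorem ch_efree_eq (Z : MCell) (w : CWord) (hw : EFree w) :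
    Z.ch w = ((∏ f, iphi (Z f) (w f) : ℤ) : GaussianInt) := by
  rw [LinePhaseTorus.ch_eq_prod]; push_cast
  exact Finset.prod_congr rfl fun f _ => bphi_eq_iphi _ _ (hw f).1 (hw f).2

/-- the class function at an e-free word is an integer sum. -/
theorem wch_efree_eq (C : MConfig) (mN mP : MCell → ℤ) (w : CWord) (hw : EFree w) :
    C.wch mN mP w = ((∑ Z ∈ C.lower, mN Z * ∏ f, iphi (Z f) (w f) -
      ∑ P ∈ C.upper, mP P * ∏ f, iphi (P f) (w f) : ℤ) : GaussianInt) := by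
  rw [wch_apply]
  simp_rw [ch_efree_eq _ w hw]
  push_cast
  rfl

/-- the class function at an e-free word is real. -/
theorem wch_efree_im (C : MConfig) (mN mP : MCell → ℤ) (w : CWord) (hw : EFree w) : (C.wch mN mP w).im = 0 := by
  rw [wch_efree_eq C mN mP w hw, Zsqrtd.im_intCast]

/-- single-survivor evaluation: if every `c_f` is supported on `{j_f, e, ē}` with `j` e-free and some slot carries no `e, ē`
coefficient, then under (A1) `HS(c) = (∏ c_f(j_f)) · N(j)`. -/
theorem HS_single (C : MConfig) (mN mP : MCell → ℤ) (c : Fin 4 → Fin 6 → GaussianInt) (j : CWord) (hj : EFree j)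
    (hc : ∀ f k, c f k ≠ 0 → k = j f ∨ k = 3 ∨ k = 4) (f₀ : Fin 4) (h3 : c f₀ 3 = 0) (h4 : c f₀ 4 = 0)
    (hA1 : ClassScreen (C.wch mN mP)) :
    HS C mN mP c = (∏ f, c f (j f)) * C.wch mN mP j := by
  rw [HS_split C mN mP c hA1, Finset.prod_eq_zero (Finset.mem_univ f₀) h3, Finset.prod_eq_zero (Finset.mem_univ f₀) h4,
    zero_mul, zero_mul, add_zero, add_zero]
  rw [Finset.sum_eq_single j]
  · intro w hw hne
    rw [Finset.mem_filter] at hw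
    have : ∃ f, c f (w f) = 0 := by
      by_contra hcon
      push Not at hcon
      apply hne
      funext f
      rcases hc f (w f) (hcon f) with e | e | e
      · exact e
      · exact absurd e (hw.2 f).1
      · exact absurd e (hw.2 f).2
    rw [prod_coef_eq_zero this, zero_mul]
  · intro hnot
    exact absurd (Finset.mem_filter.mpr ⟨Finset.mem_univ _, hj⟩) hnot

/-- the ladder engine: `(∏ d_f) ∣ a · N(j)` whenever `HS(c) = a·N(j)`, the functionals are integer-valued (`g`) and `d_f ∣ g_f`
letterwise on parity-axial letters. -/
theorem ladder_core (C : MConfig) (mN mP : MCell → ℤ)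
    (hpa : ∀ Z ∈ C.lower ∪ C.upper, ∀ f, ParityAxial (Z f)) (hA1 : ClassScreen (C.wch mN mP))
    (c : Fin 4 → Fin 6 → GaussianInt) (g : Fin 4 → BPoint → ℤ) (hcg : ∀ f x, lfun (c f) x = ((g f x : ℤ) : GaussianInt))
    (d : Fin 4 → ℤ) (hd : ∀ f x, ParityAxial x → d f ∣ g f x)
    (j : CWord) (hj : EFree j) (hc : ∀ f k, c f k ≠ 0 → k = j f ∨ k = 3 ∨ k = 4) (f₀ : Fin 4)
    (h3 : c f₀ 3 = 0) (h4 : c f₀ 4 = 0) (a : ℤ) (ha : (∏ f, c f (j f)) = (a : GaussianInt)) :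
    (∏ f, d f) ∣ a * (C.wch mN mP j).re := by
  have e := HS_single C mN mP c j hj hc f₀ h3 h4 hA1
  rw [HS_eq_HSint C mN mP c g hcg, ha] at e
  have dv : (∏ f, d f) ∣ HSint C mN mP g :=
    dvd_HSint _ _ _ _ _ fun Z hZ => Finset.prod_dvd_prod_of_dvd _ _ fun f _ => hd f _ (hpa Z hZ f)
  have ere := congrArg Zsqrtd.re e
  have : ((a : GaussianInt) * C.wch mN mP j).re = a * (C.wch mN mP j).re := by simp
  rw [Zsqrtd.re_intCast, this] at ere
  rwa [ere] at dv

/-- the words `u111, uu11, uuu1, uuup, uupp, uppp, pppp`. -/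
def lw1 : CWord := ![1, 0, 0, 0]
/-- the e-free ladder word of degree `2`. -/
def lw2 : CWord := ![1, 1, 0, 0]
/-- the e-free ladder word of degree `3`. -/
def lw3 : CWord := ![1, 1, 1, 0]
/-- the e-free ladder word of degree `5`. -/
def lw5 : CWord := ![1, 1, 1, 5]
/-- the e-free ladder word of degree `6`. -/
def lw6 : CWord := ![1, 1, 5, 5]
/-- the e-free ladder word of degree `7`. -/
def lw7 : CWord := ![1, 5, 5, 5]
/-- the e-free ladder word of degree `8`. -/
def lw8 : CWord := ![5, 5, 5, 5]

/-- `c1` is supported on the letter `1`. -/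
theorem c1_support (k : Fin 6) (hk : c1 k ≠ 0) : k = 0 := by
  fin_cases k <;> simp_all [c1]
/-- `cP` is supported on the letter `p`. -/
theorem cP_support (k : Fin 6) (hk : cP k ≠ 0) : k = 5 := by
  fin_cases k <;> simp_all [cP]

/-- **THE LADDER** (with §5's `16 ∣ N(uuuu)`): `2 ∣ N(u111)`, `4 ∣ N(uu11)`, `8 ∣ N(uuu1)`, `32 ∣ N(uuup)`, `64 ∣ N(uupp)`,
`128 ∣ N(uppp)`, `256 ∣ N(pppp)` — and by (A1)(ii) the same for every e-free word of the same degree. -/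
theorem parityAxialDesign_ladder (C : MConfig) (mN mP : MCell → ℤ)
    (hpa : ∀ Z ∈ C.lower ∪ C.upper, ∀ f, ParityAxial (Z f)) (hA1 : ClassScreen (C.wch mN mP)) :
    (2 : ℤ) ∣ (C.wch mN mP lw1).re ∧ (4 : ℤ) ∣ (C.wch mN mP lw2).re ∧ (8 : ℤ) ∣ (C.wch mN mP lw3).re ∧
    (32 : ℤ) ∣ (C.wch mN mP lw5).re ∧ (64 : ℤ) ∣ (C.wch mN mP lw6).re ∧ (128 : ℤ) ∣ (C.wch mN mP lw7).re ∧
    (256 : ℤ) ∣ (C.wch mN mP lw8).re := by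
  have LC := ladder_core C mN mP hpa hA1
  -- letterwise divisibilities
  have dG : ∀ x, ParityAxial x → (4 : ℤ) ∣ gG x := fun x hx => four_dvd_G hx
  have dP : ∀ x, ParityAxial x → (4 : ℤ) ∣ gP x := fun x hx => four_dvd_p hx
  have d1 : ∀ x, ParityAxial x → (1 : ℤ) ∣ g1 x := fun x _ => one_dvd _
  have sG : ∀ k, cG k ≠ 0 → k = 1 ∨ k = 3 ∨ k = 4 := cG_support
  have s1 : ∀ (j : Fin 6) k, j = 0 → c1 k ≠ 0 → k = j ∨ k = 3 ∨ k = 4 := fun j k hj hk => Or.inl (hj ▸ c1_support k hk)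
  have sP : ∀ (j : Fin 6) k, j = 5 → cP k ≠ 0 → k = j ∨ k = 3 ∨ k = 4 := fun j k hj hk => Or.inl (hj ▸ cP_support k hk)
  refine ⟨?_, ?_, ?_, ?_, ?_, ?_, ?_⟩
  · have h := LC ![cG, c1, c1, c1] ![gG, g1, g1, g1]
      (fun f x => by fin_cases f <;> first | exact lfun_cG x | exact lfun_c1 x) ![4, 1, 1, 1]
      (fun f x hx => by fin_cases f <;> first | exact dG x hx | exact d1 x hx) lw1 (by decide)
      (fun f k hk => by fin_cases f <;> first | exact sG k hk | exact s1 _ k rfl hk) 1 rfl rfl 2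
      (by rw [Fin.prod_univ_four]; decide)
    rw [Fin.prod_univ_four] at h; norm_num at h
    exact (mul_dvd_mul_iff_left (by norm_num : (2 : ℤ) ≠ 0)).mp (by simpa [show (4 : ℤ) = 2 * 2 by norm_num] using h)
  · have h := LC ![cG, cG, c1, c1] ![gG, gG, g1, g1]
      (fun f x => by fin_cases f <;> first | exact lfun_cG x | exact lfun_c1 x) ![4, 4, 1, 1]
      (fun f x hx => by fin_cases f <;> first | exact dG x hx | exact d1 x hx) lw2 (by decide)
      (fun f k hk => by fin_cases f <;> first | exact sG k hk | exact s1 _ k rfl hk) 2 rfl rfl 4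
      (by rw [Fin.prod_univ_four]; decide)
    rw [Fin.prod_univ_four] at h; norm_num at h
    exact (mul_dvd_mul_iff_left (by norm_num : (4 : ℤ) ≠ 0)).mp (by simpa [show (16 : ℤ) = 4 * 4 by norm_num] using h)
  · have h := LC ![cG, cG, cG, c1] ![gG, gG, gG, g1]
      (fun f x => by fin_cases f <;> first | exact lfun_cG x | exact lfun_c1 x) ![4, 4, 4, 1]
      (fun f x hx => by fin_cases f <;> first | exact dG x hx | exact d1 x hx) lw3 (by decide)
      (fun f k hk => by fin_cases f <;> first | exact sG k hk | exact s1 _ k rfl hk) 3 rfl rfl 8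
      (by rw [Fin.prod_univ_four]; decide)
    rw [Fin.prod_univ_four] at h; norm_num at h
    exact (mul_dvd_mul_iff_left (by norm_num : (8 : ℤ) ≠ 0)).mp (by simpa [show (64 : ℤ) = 8 * 8 by norm_num] using h)
  · have h := LC ![cG, cG, cG, cP] ![gG, gG, gG, gP]
      (fun f x => by fin_cases f <;> first | exact lfun_cG x | exact lfun_cP x) ![4, 4, 4, 4]
      (fun f x hx => by fin_cases f <;> first | exact dG x hx | exact dP x hx) lw5 (by decide)
      (fun f k hk => by fin_cases f <;> first | exact sG k hk | exact sP _ k rfl hk) 3 rfl rfl 8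
      (by rw [Fin.prod_univ_four]; decide)
    rw [Fin.prod_univ_four] at h; norm_num at h
    exact (mul_dvd_mul_iff_left (by norm_num : (8 : ℤ) ≠ 0)).mp (by simpa [show (256 : ℤ) = 8 * 32 by norm_num] using h)
  · have h := LC ![cG, cG, cP, cP] ![gG, gG, gP, gP]
      (fun f x => by fin_cases f <;> first | exact lfun_cG x | exact lfun_cP x) ![4, 4, 4, 4]
      (fun f x hx => by fin_cases f <;> first | exact dG x hx | exact dP x hx) lw6 (by decide)
      (fun f k hk => by fin_cases f <;> first | exact sG k hk | exact sP _ k rfl hk) 3 rfl rfl 4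
      (by rw [Fin.prod_univ_four]; decide)
    rw [Fin.prod_univ_four] at h; norm_num at h
    exact (mul_dvd_mul_iff_left (by norm_num : (4 : ℤ) ≠ 0)).mp (by simpa [show (256 : ℤ) = 4 * 64 by norm_num] using h)
  · have h := LC ![cG, cP, cP, cP] ![gG, gP, gP, gP]
      (fun f x => by fin_cases f <;> first | exact lfun_cG x | exact lfun_cP x) ![4, 4, 4, 4]
      (fun f x hx => by fin_cases f <;> first | exact dG x hx | exact dP x hx) lw7 (by decide)
      (fun f k hk => by fin_cases f <;> first | exact sG k hk | exact sP _ k rfl hk) 3 rfl rfl 2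
      (by rw [Fin.prod_univ_four]; decide)
    rw [Fin.prod_univ_four] at h; norm_num at h
    exact (mul_dvd_mul_iff_left (by norm_num : (2 : ℤ) ≠ 0)).mp (by simpa [show (256 : ℤ) = 2 * 128 by norm_num] using h)
  · have h := LC ![cP, cP, cP, cP] ![gP, gP, gP, gP]
      (fun f x => by fin_cases f <;> exact lfun_cP x) ![4, 4, 4, 4]
      (fun f x hx => by fin_cases f <;> exact dP x hx) lw8 (by decide)
      (fun f k hk => by fin_cases f <;> exact sP _ k rfl hk) 0 rfl rfl 1
      (by rw [Fin.prod_univ_four]; decide)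
    rw [Fin.prod_univ_four] at h; norm_num at h
    exact h

end Summit.Ventures.HSemireg.HalfSum
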